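import Summits.HodgeConjecture.HodgeConjecture.Theorems.UeP4bHodgeFrameMarkingsFamily
import HarnessLib

/-!
# U-e P4 (B1b): the PIECE instance of the family edition — `ueP4b1b_hodgeFrameMarkings_piece`

Cell hodgecm-mathlib (D-0151), rung 0 of the Mumford line under `HDel` (item `stmt-HodgeConjecture-24835`), (U)-lane node U-e
P4, PIECE EDITION (B-plan1 (g13) GO-PIECE 2026-08-29T18:25Z, «P4 is local on the base»).  THE PIECE INSTANCE of
`ueP4b1b_hodgeFrameMarkings_family` (★ `UeP4bHodgeFrameMarkingsFamily`; the instance `f := univFamilyℂ 𝓜` is ★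
`ueP4b1b_hodgeFrameMarkings` itself): **(B1b-piece)** for the restricted universal family `familyPullback.snd (univFamilyℂ 𝓜) ι`
over an open piece `ι : S′ → M ⊗ ℂ` smooth of pure dimension `d`, fibre triples classified by `ι x`, pinned identifications
through ★ `fiberOverFamilyPullbackIso`, charts of `S′` — the socket `UHead.Ue_P4b1b_hodgeFrameMarkings_piece` of the piece
sockets (lead B-p03 (g14)) in notion-free tree shape, the shape the E-road («EQUIDIM from (F)», gap G-AN1) consumes.  HC_CM is proved only modulo the 7 printed citations until rung 0 closes; nothing here
changes that count (books 0).

## References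

* [LangeBirkenhake1992] H. Lange, Ch. Birkenhake, *Complex Abelian Varieties* (1992), Ch. 8 §8.1–8.2 (Prop. 8.1.1).
* [VoisinHodgeI2002] C. Voisin, *Hodge Theory and Complex Algebraic Geometry I* (2002), §10.2.1 Thm. 10.3.
* [MumfordFogartyKirwan1994] D. Mumford, J. Fogarty, F. Kirwan, *Geometric Invariant Theory* (3rd ed.), Appendix to Ch. 7 §A (p. 235).
-/

set_option autoImplicit false
set_option linter.dupNamespace false

noncomputable section

open CategoryTheory CategoryTheory.Limits AlgebraicGeometry Matrix Topology
open Literature.AlgebraicGeometry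
open scoped TensorProduct Manifold
open Literature.AlgebraicGeometry.Motives (SchemeOver ComplexPoints AlgPoints specOver AbelianVariety CartierDivisor fiberOver
  IsSmoothProjective ofRatClassBaseChange)
open Literature.AlgebraicGeometry.AbelianSchemes (PolarizedAbelianSchemeWithLevel AbelianSchemeOver)
open Literature.Geometry.Kaehler (ComplexTorus)
open Literature.Geometry.Kaehler.ComplexTorus (AHData periodMatrix intGram latticeGram IsRiemannForm proj picClass)
open Literature.NumberTheory.Transcendental (IsAnalytification)
open Literature.NumberTheory.Automorphic (siegelUpperHalfSpace)
open Literature.NumberTheory.Adeles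
open Literature.AlgebraicTopology.SingularHomology
open Literature.AlgebraicGeometry.ModuliOfAbelianVarieties
open Literature.AlgebraicGeometry.HodgeTheory

namespace Summit.HodgeConjecture.HodgeConjecture.Theorems

namespace UeP4bHodgeFrameMarkings

open SiegelModuli
/-! ### The piece instance -/

section Instances

/-- **(B1b-piece): THE PIECE INSTANCE** `f := familyPullback.snd (univFamilyℂ 𝓜) ι` of the family edition, for an open
piece `ι : S′ → M ⊗ ℂ` smooth of pure dimension `d` ((F-c′)/(F-c″) give the quasi-projectivity of `S′` and of the restricted
total space, ★ `isQuasiProjectiveOver_of_isOpenImmersion_M` / `isQuasiProjectiveOver_familyPullback_univFamilyℂ`; the family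
is smooth projective, ★ `isSmoothProjectiveFamily_familyPullback_univFamilyℂ`): fibre triples classified by the points `ι x`,
pinned `e x := homeomorphOfIso (fibreAVIso ≪≫ (fiberUnivIso 𝓜 (ι x))⁻¹ ≪≫ (fiberOverFamilyPullbackIso (univFamilyℂ 𝓜) ι x)⁻¹)`,
charts `algebraicChart S′ d` — the G-AN1 shape «P4 is local on the base» for the E-road.
[cite: LangeBirkenhake1992, Ch. 8 §8.1–8.2 (Prop. 8.1.1)] [cite: VoisinHodgeI2002, §10.2.1 Thm. 10.3] -/
theorem ueP4b1b_hodgeFrameMarkings_piece :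
  ∀ (g N : ℕ) (δ : Fin g → ℕ) (_hg : 0 < g) (hδ : IsPolarizationType δ) (_hN : 3 ≤ N)
    (𝓜 : SiegelFineModuliScheme g N δ) (_hMq : IsQuasiProjectiveOver 𝓜.M)
    (_hXq : IsQuasiProjectiveOver (W1.univTotal 𝓜))
    {S' : SchemeOver ℂ} (ι : S' ⟶ (Motives.baseChange ℚ ℂ).obj 𝓜.M) [IsOpenImmersion ι.left]
    (r : gspFinAdelic δ)
    (d : ℕ) [SmoothOfRelativeDimension d S'.hom],
    haveI : IsLocallyNoetherian (specOver ℚ ℂ).left :=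
      inferInstanceAs (IsLocallyNoetherian (Spec (CommRingCat.of ℂ)))
    haveI : Smooth S'.hom := SmoothOfRelativeDimension.smooth d _
    haveI : LocallyOfFiniteType S'.hom := inferInstance
    r ∈ principalLevelSubgroup δ 1 →
    ∀ (Z₀ : Matrix (Fin g) (Fin g) ℂ) (hZ₀ : Z₀ ∈ siegelUpperHalfSpace g)
      (W : Set (ComplexPoints S')) (_hWo : IsOpen W) (_hW : IsPathConnected W)
      (x₀ : W)
      (_hWc : W ⊆ (ComplexPoints.algebraicChart S' d
        (x₀ : ComplexPoints S')).source)
      (hU : IsCohomologicallyLocallyTrivialOn (Motives.familyPullback.snd (W1.univFamilyℂ 𝓜) ι) W)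
      (P' : W → PolarizedAbelianSchemeWithLevel g N δ (specOver ℚ ℂ).left)
      (G : ∀ x : W, (P' x).A.X.left ⟶ 𝓜.univ.A.X.left) (Ĝ : ∀ x : W, (P' x).D.hat.X.left ⟶ 𝓜.univ.D.hat.X.left)
      (hbc : ∀ x : W, (P' x).IsBaseChangeVia 𝓜.univ
        ((AlgPoints.baseChangeEquiv (algebraMap ℚ ℂ) 𝓜.M).symm (AlgPoints.map ι x.1)).left (G x) (Ĝ x))
      (γ : ∀ x : W, Fin g ⊕ Fin g →
        singularCohomology ℚ ℚ (ComplexPoints (fiberOver (Motives.familyPullback.snd (W1.univFamilyℂ 𝓜) ι) x.1)) 1)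
      (Φ : ∀ _x : W, (Fin g ⊕ Fin g → ℝ) ≃L[ℝ] (Fin g → ℂ))
      (φ : ∀ x : W, C(ComplexTorus (Φ x), ((P' x).A.fibre (𝟙 (Spec (CommRingCat.of ℂ)))).toAbelianVariety.Points ℂ))
      (Θ : ∀ x : W, CartierDivisor ((P' x).A.fibre (𝟙 (Spec (CommRingCat.of ℂ)))).toAbelianVariety.X.left)
      (m₀ : SiegelAdelicMarking ⟨jOfSiegel δ Z₀, SiegelComplexRecordSystem.jOfSiegel_mem_C0pm hδ.1 hZ₀⟩ r
        ((P' x₀).A.fibre (𝟙 (Spec (CommRingCat.of ℂ)))).toAbelianVariety)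
      (Λ₀ : (P' x₀).level.SymplecticLift (𝟙 (Spec (CommRingCat.of ℂ))) (Θ x₀) δ),
      (∀ x : W, AlgPoints.baseChangeEquiv (algebraMap ℚ ℂ) 𝓜.M (𝓜.classifyingMap (specOver ℚ ℂ) (P' x)) =
        AlgPoints.map ι x.1) →
      -- (N1) `γ` is a flat integral frame over `W`: the three clauses of B-typ02's HOME notion
      -- `HodgeTheory.IsFlatIntegralFrame (Motives.familyPullback.snd (W1.univFamilyℂ 𝓜) ι) hU γ` (only (iii), flatness inside `W`, is used here)
      ((∀ x : W, LinearIndependent ℂ fun a => ofRatClass _ 1 (γ x a)) ∧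
        (∀ (x : W) (c : complexBetti (fiberOver (Motives.familyPullback.snd (W1.univFamilyℂ 𝓜) ι) x.1) 1),
          IsIntegralClass c ↔ c ∈ Submodule.span ℤ (Set.range fun a => ofRatClass _ 1 (γ x a))) ∧
        ∀ (x x' : W) (p : Path.Homotopic.Quotient x x') (a : Fin g ⊕ Fin g),
          transportFun (Motives.familyPullback.snd (W1.univFamilyℂ 𝓜) ι) 1 hU p (ofRatClass _ 1 (γ x a)) = ofRatClass _ 1 (γ x' a)) →
      -- the uniformisations: analytifications, additive, framed by `γ x` through the pinned `e x`
      (hφ : ∀ x : W, IsAnalytification (Fin g → ℂ)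
        ((P' x).A.fibre (𝟙 (Spec (CommRingCat.of ℂ)))).toAbelianVariety.X
        ((P' x).A.fibre (𝟙 (Spec (CommRingCat.of ℂ)))).toAbelianVariety.dim (φ x)) →
      (∀ (x : W) (s t : ComplexTorus (Φ x)), φ x (s + t) = φ x s * φ x t) →
      (∀ (x : W) (a : Fin g ⊕ Fin g),
        singularCohomology.map ℚ ℚ
            (((Motives.AlgPoints.homeomorphOfIso (L := ℂ)
                (W1.fibreAVIso (P' x) ≪≫
                  (W1.fiberUnivIsoOfIsBaseChangeVia 𝓜 (AlgPoints.map ι x.1) (P' x) (G x) (Ĝ x) (hbc x)).symm ≪≫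
                  (Motives.fiberOverFamilyPullbackIso (W1.univFamilyℂ 𝓜) ι x.1).symm) :
                ((P' x).A.fibre (𝟙 (Spec (CommRingCat.of ℂ)))).toAbelianVariety.Points ℂ ≃ₜ
                  ComplexPoints (fiberOver (Motives.familyPullback.snd (W1.univFamilyℂ 𝓜) ι) x.1)) :
              C(((P' x).A.fibre (𝟙 (Spec (CommRingCat.of ℂ)))).toAbelianVariety.Points ℂ,
                ComplexPoints (fiberOver (Motives.familyPullback.snd (W1.univFamilyℂ 𝓜) ι) x.1))).comp (φ x)) 1 (γ x a) =
          latticeClass (Φ x) a) →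
      (∀ x : W, (Θ x).IsAmple) →
      (∀ x : W, (P' x).A.IsLambdaOfAt (𝟙 (Spec (CommRingCat.of ℂ))) (P' x).D (P' x).pol.lam (Θ x)) →
      -- base case at `x₀`
      m₀.γ = 1 → m₀.Ψ = Φ x₀ → (∀ t : ComplexTorus (Φ x₀), m₀.toFun t = φ x₀ t) →
      (∀ ⦃M : ℕ⦄, N ∣ M → M ≠ 0 → ∀ (c : Fin g ⊕ Fin g → ZMod M) (v : Fin g ⊕ Fin g → ℚ),
        AdelicCongr ((r⁻¹ : gspFinAdelic δ) : GL (Fin g ⊕ Fin g) finAdeleQ) 1 v (fun i => ((c i).val : ℚ) / M) →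
          ((Λ₀.lift M (Multiplicative.ofAdd c)) :
              ((P' x₀).A.fibre (𝟙 (Spec (CommRingCat.of ℂ)))).toAbelianVariety.Points ℂ) = m₀.r v) →
      -- Gram `E_δ` at `x₀` in `m₀`'s currency ((G₀))
      (∀ p : ComplexTorus.AHData m₀.Ψ,
        ComplexTorus.AHData.toPic p =
            ComplexTorus.picClass (cartierDivisorLineBundle m₀.isAnalytification (Θ x₀)) →
          ComplexTorus.intGram m₀.Ψ p.form = typeForm δ) →
      -- flat Gram ((N3-core))
      (∀ (x₁ x : W) (p₁ : ComplexTorus.AHData (Φ x₁)) (p : ComplexTorus.AHData (Φ x)),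
        ComplexTorus.AHData.toPic p₁ =
            ComplexTorus.picClass (cartierDivisorLineBundle (hφ x₁) (Θ x₁)) →
        ComplexTorus.AHData.toPic p =
            ComplexTorus.picClass (cartierDivisorLineBundle (hφ x) (Θ x)) →
        ComplexTorus.intGram (Φ x) p.form = ComplexTorus.intGram (Φ x₁) p₁.form) →
      ∃ (π : ComplexPoints S' → Matrix (Fin g) (Fin g) ℂ)
        (J : W → C0pm δ)
        (mark : ∀ x : W, SiegelAdelicMarking (J x) r ((P' x).A.fibre (𝟙 (Spec (CommRingCat.of ℂ)))).toAbelianVariety),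
        -- the markings ARE the given uniformisations
        (∀ x : W, (mark x).γ = 1) ∧
        (∀ x : W, (mark x).Ψ = Φ x) ∧
        (∀ (x : W) (t : ComplexTorus (Φ x)), (mark x).toFun t = φ x t) ∧
        -- `IsMarkingFrame e γ`, unfolded
        (∀ (x : W) (a : Fin g ⊕ Fin g),
          singularCohomology.map ℚ ℚ
              (((Motives.AlgPoints.homeomorphOfIso (L := ℂ)
                  (W1.fibreAVIso (P' x) ≪≫
                    (W1.fiberUnivIsoOfIsBaseChangeVia 𝓜 (AlgPoints.map ι x.1) (P' x) (G x) (Ĝ x) (hbc x)).symm ≪≫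
                    (Motives.fiberOverFamilyPullbackIso (W1.univFamilyℂ 𝓜) ι x.1).symm) :
                  ((P' x).A.fibre (𝟙 (Spec (CommRingCat.of ℂ)))).toAbelianVariety.Points ℂ ≃ₜ
                    ComplexPoints (fiberOver (Motives.familyPullback.snd (W1.univFamilyℂ 𝓜) ι) x.1)) :
                C(((P' x).A.fibre (𝟙 (Spec (CommRingCat.of ℂ)))).toAbelianVariety.Points ℂ,
                  ComplexPoints (fiberOver (Motives.familyPullback.snd (W1.univFamilyℂ 𝓜) ι) x.1))).comp
                ⟨(mark x).toFun, (mark x).isAnalytification.isHomeomorph.continuous⟩) 1 (γ x a) =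
            latticeClass (mark x).Ψ a) ∧
        -- `IsFlatGram Θ`, unfolded
        (∀ x : W, ∃ p : ComplexTorus.AHData (mark x).Ψ,
          ComplexTorus.AHData.toPic p =
              ComplexTorus.picClass (cartierDivisorLineBundle (mark x).isAnalytification (Θ x)) ∧
            ComplexTorus.intGram (mark x).Ψ p.form = typeForm δ) ∧
        -- `IsSiegelNormalised hδ (fun x ↦ π x.1)`, unfolded
        (∀ x : W, ∃ hx : π x.1 ∈ siegelUpperHalfSpace g,
          J x = ⟨jOfSiegel δ (π x.1), SiegelComplexRecordSystem.jOfSiegel_mem_C0pm hδ.1 hx⟩) ∧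
        ContinuousOn π W ∧
        (∀ x ∈ W, ∀ (i j : Fin g),
          DifferentiableOn ℂ
            ((fun y ↦ π y i j) ∘ (ComplexPoints.algebraicChart S' d x).symm)
            ((ComplexPoints.algebraicChart S' d x).target ∩
              (ComplexPoints.algebraicChart S' d x).symm ⁻¹' W)) ∧
        π (x₀ : ComplexPoints S') = Z₀ ∧
        (∀ i : Fin g ⊕ Fin g, ∃ v : Fin g ⊕ Fin g → ℚ,
          AdelicCongr ((r⁻¹ : gspFinAdelic δ) : GL (Fin g ⊕ Fin g) finAdeleQ) 1 v
              (fun j => (((Pi.single i (1 : ZMod N) : Fin g ⊕ Fin g → ZMod N) j).val : ℚ) / N) ∧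
            (P' x₀).A.restrictPt (𝟙 (Spec (CommRingCat.of ℂ))) ((P' x₀).level.σ i) = (mark x₀).r v) := by
  intro g N δ hg hδ hN 𝓜 hMq hXq S' ι _ r d _ hr Z₀ hZ₀ W hWo hWpc x₀ hWc hU P' G Ĝ hbc γ Φ φ Θ m₀ Λ₀ _hcls hN1 hφ hadd
    hframe hΘ hlam hγ₀ hΨ₀ hu₀ htower hG₀ hconst
  exact ueP4b1b_hodgeFrameMarkings_family g N δ hg hδ hN (Motives.familyPullback.snd (W1.univFamilyℂ 𝓜) ι)
    (UnivFamilyHodgeFrames.isSmoothProjectiveFamily_familyPullback_univFamilyℂ 𝓜 ι)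
    (UnivFamilyHodgeFrames.isQuasiProjectiveOver_of_isOpenImmersion_M 𝓜 hMq ι)
    (UnivFamilyHodgeFrames.isQuasiProjectiveOver_familyPullback_univFamilyℂ 𝓜 hXq ι) r d hr Z₀ hZ₀ W hWo hWpc x₀ hWc hU P'
    (fun x ↦ W1.fibreAVIso (P' x) ≪≫
      (W1.fiberUnivIsoOfIsBaseChangeVia 𝓜 (AlgPoints.map ι x.1) (P' x) (G x) (Ĝ x) (hbc x)).symm ≪≫
      (Motives.fiberOverFamilyPullbackIso (W1.univFamilyℂ 𝓜) ι x.1).symm)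
    γ Φ φ Θ m₀ Λ₀ hN1 hφ hadd hframe hΘ hlam hγ₀ hΨ₀ hu₀ htower hG₀ hconst

end Instances

end UeP4bHodgeFrameMarkings

end Summit.HodgeConjecture.HodgeConjecture.Theorems

end
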